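import Summits.NavierStokesRegularity.FunctionalMining.NoGo.TopEigHeatLaminateFamily
import Summits.NavierStokesRegularity.FunctionalMining.NoGo.TopBotEigHeatWindow
import HarnessLib

/-!
# FunctionalMining / NoGo — K34b: the POINCARÉ CEILING on Lemma L-λ's constant is STRICT —
# `C_λ(q) < 4π²q` and `C_λ^sym(q) < 4π²q` for every real `q ≥ 1`, `q ≠ 2`; the family ceiling `C_λ(q) ≤ ρ(q,b)`

HONEST FRAMING. Search for candidate a priori estimates; no regularity claim. Nothing about
Navier–Stokes is proved or asserted in this file: it evaluates the dictionary's STATIC heat-line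
functionals (`heatDissipation Φ v = sup_{t>0} (Φ(v) − Φ(v + tΔv))/t`, `TopEigHeatCoercive.lean`; no transport,
no pressure) along the heat line of ONE explicit two-parameter family of smooth divergence-free zero-mean
fields of `T³` — K34a's laminates `u_F = (F_{q,b}(x₂), 0, 0)`, `F′ = S·(1 + bS²)^{2/q}`, `S = sin 2π·`, `b > −1`
(`NoGo/TopEigHeatLaminateFamily.lean`) — and books the outcome against `C_λ(q) = TopEig.topEigHeatRate q`
(kernel window `[0, 4π²q]`, `TopEigHeatRate.lean`: the ceiling `topEigHeatRate_le` is the single-shell /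
Poincaré rate) and K6's `C_λ^sym(q) = topBotEigHeatRate q` (`NoGo/TopBotEigHeatWindow.lean`).
Cell `pub-nsfunc`, no-go seat (gen 46); sequel of K32/K33a/K33b and K34a. [ours]

* §1 INTEGRATION (K33a's Wallis moments `I(a) = sinAbsMoment a` and recursion `(r+2)I(r+2) = (r+1)I(r)`):
  `∫₀¹|F′|^q = I(q) + 2bI(q+2) + b²I(q+4)` (`integral_famF_rpow_zero`) and, from K34a's pointwise bound,
  `(1 + tq4π²P₀)I(q) + (2b + tq4π²P₁)I(q+2) + (b² + tq4π²P₂)I(q+4) ≤ ∫₀¹|F′ + tF‴|^q` for EVERY real `t`, `q ≥ 1`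
  (`integral_famLine_rpow_ge`); hence the HEAT-LINE DROP **`∫|F′|^q − ∫|F′ + tF‴|^q ≤ t·ρ(q,b)·∫|F′|^q`**
  (`integral_famLine_drop_le`, `q > 1`) with the FAMILY RATE (`famRate`)
  **`ρ(q,b) = 4π²·N(q,b)/D(q,b)`**, `N = q²(q+2)(q+4) + 2bq(q−1)(q+4)² + b²(q−1)(q+1)(q+4)²` (`famN`),
  `D = q(q+2)(q+4) + 2bq(q+1)(q+4) + b²q(q+1)(q+3) > 0` (`famD`, `famD_pos`);
* §2 BOOKING (`topEigHeatRate_le_ratio`, K6 `topBotEigHeatRate_le_ratio`, K33a `heatDissipation_le_of_line`):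
  **`topEigHeatRate_le_famRate : C_λ(q) ≤ ρ(q,b)`**, `negBotEigHeatRate_le_famRate`,
  **`topBotEigHeatRate_le_famRate : C_λ^sym(q) ≤ ρ(q,b)`** for every real `q > 1` and every `b > −1`;
* §3 STRICTNESS: `ρ(q,0) = 4π²q` (the pure sine is the Poincaré extremal) and
  `N − qD = 4b·(q(q+4)(q−2) + b(q+1)(q²+2q−4))` (`famN_sub`), so at `b⋆ = (2−q)/(2q³)` (`famBStar`, `> −1`)
  `N − qD = −(q−2)²(2q⁴(q+4) − (q+1)(q²+2q−4))/q⁶ < 0` for `q ≥ 1`, `q ≠ 2` (`famRate_bStar_lt`). HEADLINE: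
  **`topEigHeatRate_lt_poincare : C_λ(q) < 4π²q`**, **`topBotEigHeatRate_lt_poincare : C_λ^sym(q) < 4π²q`**,
  `negBotEigHeatRate_lt_poincare`, for EVERY real `q ≥ 1` with `q ≠ 2` (the endpoint `q = 1` is K32); in no-go
  words **`not_topEigHeatCoercive_poincare : ¬ TopEigHeatCoercive q (4π²q)`** and `¬ HeatCoercive (Φ_q+Ψ_q)(4π²q)`:
  the single-shell rate is NOT an admissible heat rate for `∫(λ₁⁺)^q` at any `q ≠ 2` — the tree's ceiling
  (`topEigHeatRate_le`, `topBotEigHeatRate_le`) is attained by NO `q ∈ [1,∞) \ {2}`;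
  at `q = 2` the family is rigid: `N(2,b) − 2D(2,b) = 48b² ≥ 0`, `8π² ≤ ρ(2,b)` (`famRate_two_ge`; tree
  `laminate_rigid_two`: no laminate goes below `8π²` at `q = 2`, so `C_λ(2) < 8π²` stays OPEN here);
* §4 SAMPLE WINDOWS (exact rationals): `C_λ^sym(3) ≤ (5796/509)π² < 11.4π²` (tree: `12π²`),
  `C_λ^sym(4) ≤ (128/9)π²` (tree: `16π²`), `C_λ^sym(8) ≤ 24π²` (tree: `32π²`), and the same for `C_λ`.

SCOPE, EXACTLY: UPPER bounds on `C_λ(q)`, `C_λ^−(q)`, `C_λ^sym(q)` only. No lower bound is proved: Lemma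
L-λ(q) (`C_λ(q) > 0`) stays OPEN in the kernel for every real `q > 1`; the laminates are NOT kills for `q > 1`
(their heat price is positive); `ρ(q,b)` is not claimed optimal among laminates (pen: the laminate infimum is
`< ρ(q,b⋆)`), and nothing is said about `q = 2` beyond the tree's `≤ 8π²`, nor about `q < 1`.
PROVENANCE / STATUS. Typed by the no-go seat (gen 46); exact-rational sanity of N, D, the identities and the
windows in `pub-nsfunc-nogo/sieveld/lamfam/identities.py` (stdlib); farm-checked at CONCAT grade (K32 ++ K33a ++
K34a ++ this body under their TREE imports: `lean check` rc 0, 0 sorries, 0 warnings; axioms standard).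
STATUS: STAGED (files after K32, K33a and K34a are built).
FILING (prove seat g28, REQUEST #52): declarations byte-identical to the no-go seat's staged `TopEigHeatPoincareStrict.STAGING.lean` a41b31b99f790508; this line is the only addition.
-/

noncomputable section

open MeasureTheory Set intervalIntegral Real
open scoped ContDiff Topology

namespace Summit.NavierStokesRegularity.FunctionalMining

open Literature.Analysis Literature.Analysis.FunctionSpaces Literature.Analysis.FunctionSpaces.Torus
open TopEig PlanarTopEig StrainL4 LaminateDirection
open Literature.Analysis.FluidPDE.LeiZhang2011 (abs_rpow_mul_sq) -- landed [folklore] lemma, via K33aʼs import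

namespace TopEigLaminate

variable {q b : ℝ} (hb : -1 < b)

/-! ## 1. Integration: Wallis moments, the family rate, the heat-line drop -/

/-- `|S|^q·y_b(s)² = |S|^q + 2b|S|^{q+2} + b²|S|^{q+4}` (`q ≥ 0`; `S = sin 2πs`). [ours, bookkeeping] -/
theorem abs_rpow_mul_famBase_sq (hq : 0 ≤ q) (b s : ℝ) :
    |sin (2 * π * s)| ^ q * famBase b s ^ 2 = |sin (2 * π * s)| ^ q +
      2 * b * |sin (2 * π * s)| ^ (q + 2) + b ^ 2 * |sin (2 * π * s)| ^ (q + 4) := by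
  have h2 : |sin (2 * π * s)| ^ q * sin (2 * π * s) ^ 2 = |sin (2 * π * s)| ^ (q + 2) :=
    abs_rpow_mul_sq _ (by linarith)
  have h4 : |sin (2 * π * s)| ^ (q + 2) * sin (2 * π * s) ^ 2 = |sin (2 * π * s)| ^ (q + 4) := by
    rw [abs_rpow_mul_sq _ (by linarith), show q + 2 + 2 = q + 4 by ring]
  rw [← h4, ← h2]; unfold famBase; ring

/-- **`∫₀¹ |F′|^q = I(q) + 2b·I(q+2) + b²·I(q+4)`** (`q > 0`). [ours] -/
theorem integral_famF_rpow_zero (hq : 0 < q) :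
    ∫ s in (0 : ℝ)..1, |(famF q b hb).D s + 0 * (famF q b hb).D.D.D s| ^ q =
      sinAbsMoment q + 2 * b * sinAbsMoment (q + 2) + b ^ 2 * sinAbsMoment (q + 4) := by
  simp_rw [famF_abs_rpow_zero hb hq, abs_rpow_mul_famBase_sq hq.le]
  have hA : IntervalIntegrable (fun s : ℝ => |sin (2 * π * s)| ^ q) volume 0 1 :=
    (continuous_abs_sin_rpow hq.le).intervalIntegrable 0 1
  have hB : IntervalIntegrable (fun s : ℝ => 2 * b * |sin (2 * π * s)| ^ (q + 2)) volume 0 1 :=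
    ((continuous_abs_sin_rpow (a := q + 2) (by linarith)).intervalIntegrable 0 1).const_mul _
  have hC : IntervalIntegrable (fun s : ℝ => b ^ 2 * |sin (2 * π * s)| ^ (q + 4)) volume 0 1 :=
    ((continuous_abs_sin_rpow (a := q + 4) (by linarith)).intervalIntegrable 0 1).const_mul _
  unfold sinAbsMoment
  rw [intervalIntegral.integral_add (hA.add hB) hC, intervalIntegral.integral_add hA hB,
    intervalIntegral.integral_const_mul, intervalIntegral.integral_const_mul]

/-- **Integrated line bound** (`q ≥ 1`, every real `t`):
`(1 + tq4π²P₀)·I(q) + (2b + tq4π²P₁)·I(q+2) + (b² + tq4π²P₂)·I(q+4) ≤ ∫₀¹ |F′ + tF‴|^q`. [ours] -/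
theorem integral_famLine_rpow_ge (hq : 1 ≤ q) (t : ℝ) :
    (1 + t * (q * (4 * π ^ 2 * famP0 q b))) * sinAbsMoment q +
          (2 * b + t * (q * (4 * π ^ 2 * famP1 q b))) * sinAbsMoment (q + 2) +
        (b ^ 2 + t * (q * (4 * π ^ 2 * famP2 q b))) * sinAbsMoment (q + 4) ≤
      ∫ s in (0 : ℝ)..1, |(famF q b hb).D s + t * (famF q b hb).D.D.D s| ^ q := by
  have hf0 := continuous_abs_sin_rpow (a := q) (by linarith)
  have hf2 := continuous_abs_sin_rpow (a := q + 2) (by linarith)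
  have hf4 := continuous_abs_sin_rpow (a := q + 4) (by linarith)
  have e : ∀ s : ℝ, |sin (2 * π * s)| ^ q * famBase b s ^ 2 +
      t * (q * (4 * π ^ 2 * (|sin (2 * π * s)| ^ q * famP q b (sin (2 * π * s) ^ 2)))) =
      (1 + t * (q * (4 * π ^ 2 * famP0 q b))) * |sin (2 * π * s)| ^ q +
        (2 * b + t * (q * (4 * π ^ 2 * famP1 q b))) * |sin (2 * π * s)| ^ (q + 2) +
        (b ^ 2 + t * (q * (4 * π ^ 2 * famP2 q b))) * |sin (2 * π * s)| ^ (q + 4) := by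
    intro s
    have h2 : |sin (2 * π * s)| ^ q * sin (2 * π * s) ^ 2 = |sin (2 * π * s)| ^ (q + 2) :=
      abs_rpow_mul_sq _ (by linarith)
    have h4 : |sin (2 * π * s)| ^ (q + 2) * sin (2 * π * s) ^ 2 = |sin (2 * π * s)| ^ (q + 4) := by
      rw [abs_rpow_mul_sq _ (by linarith), show q + 2 + 2 = q + 4 by ring]
    rw [abs_rpow_mul_famBase_sq (by linarith), ← h4, ← h2]; unfold famP; ring
  have hA : IntervalIntegrable (fun s : ℝ => (1 + t * (q * (4 * π ^ 2 * famP0 q b))) *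
      |sin (2 * π * s)| ^ q) volume 0 1 := (hf0.intervalIntegrable 0 1).const_mul _
  have hB : IntervalIntegrable (fun s : ℝ => (2 * b + t * (q * (4 * π ^ 2 * famP1 q b))) *
      |sin (2 * π * s)| ^ (q + 2)) volume 0 1 := (hf2.intervalIntegrable 0 1).const_mul _
  have hC : IntervalIntegrable (fun s : ℝ => (b ^ 2 + t * (q * (4 * π ^ 2 * famP2 q b))) *
      |sin (2 * π * s)| ^ (q + 4)) volume 0 1 := (hf4.intervalIntegrable 0 1).const_mul _
  have hR : IntervalIntegrable (fun s : ℝ => |(famF q b hb).D s + t * (famF q b hb).D.D.D s| ^ q)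
      volume 0 1 :=
    (((famF q b hb).D.continuous.add (continuous_const.mul (famF q b hb).D.D.D.continuous)).abs.rpow_const
      fun _ => Or.inr (by linarith)).intervalIntegrable 0 1
  refine le_trans (le_of_eq ?_) (intervalIntegral.integral_mono_on zero_le_one ((hA.add hB).add hC) hR
    fun s _ => by rw [← e s]; exact famF_line_rpow_ge hb hq t s)
  unfold sinAbsMoment
  rw [intervalIntegral.integral_add (hA.add hB) hC, intervalIntegral.integral_add hA hB,
    intervalIntegral.integral_const_mul, intervalIntegral.integral_const_mul, intervalIntegral.integral_const_mul]

/-- **Numerator `N(q,b) = q²(q+2)(q+4) + 2bq(q−1)(q+4)² + b²(q−1)(q+1)(q+4)²`.** [ours, bookkeeping] -/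
def famN (q b : ℝ) : ℝ :=
  q ^ 2 * (q + 2) * (q + 4) + 2 * b * q * (q - 1) * (q + 4) ^ 2 + b ^ 2 * (q - 1) * (q + 1) * (q + 4) ^ 2

/-- **Denominator `D(q,b) = q(q+2)(q+4) + 2bq(q+1)(q+4) + b²q(q+1)(q+3)`.** [ours, bookkeeping] -/
def famD (q b : ℝ) : ℝ :=
  q * (q + 2) * (q + 4) + 2 * b * q * (q + 1) * (q + 4) + b ^ 2 * q * (q + 1) * (q + 3)

/-- **THE FAMILY RATE `ρ(q,b) := 4π²·N(q,b)/D(q,b)`.** [ours, bookkeeping] -/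
def famRate (q b : ℝ) : ℝ := 4 * π ^ 2 * famN q b / famD q b

/-- **`D(q,b) > 0`** for `q > 0` and every real `b`
(`(q+3)·D = q·((q+1)((q+3)b + q + 4)² + 2(q+4))`). [ours, bookkeeping] -/
theorem famD_pos (hq : 0 < q) (b : ℝ) : 0 < famD q b := by
  unfold famD
  have key : (q + 3) * ((q + 2) * (q + 4) + 2 * b * (q + 1) * (q + 4) + b ^ 2 * (q + 1) * (q + 3)) =
      (q + 1) * ((q + 3) * b + (q + 4)) ^ 2 + 2 * (q + 4) := by ring
  have hsq := sq_nonneg ((q + 3) * b + (q + 4))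
  have hin : 0 < (q + 2) * (q + 4) + 2 * b * (q + 1) * (q + 4) + b ^ 2 * (q + 1) * (q + 3) := by
    nlinarith [mul_nonneg (by linarith : (0 : ℝ) ≤ q + 1) hsq]
  nlinarith [mul_pos hq hin]

/-- `∫₀¹|F′|^q = (D(q,b)/(q(q+2)(q+4)))·I(q)` (`q > 1`; the Wallis recursion twice). [ours, bookkeeping] -/
theorem integral_famF_rpow_zero_eq (hq : 1 < q) :
    ∫ s in (0 : ℝ)..1, |(famF q b hb).D s + 0 * (famF q b hb).D.D.D s| ^ q =
      famD q b / (q * (q + 2) * (q + 4)) * sinAbsMoment q := by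
  have r1 := sinAbsMoment_rec (r := q) hq
  have r2 := sinAbsMoment_rec (r := q + 2) (by linarith)
  rw [show q + 2 + 2 = q + 4 by ring, show q + 2 + 1 = q + 3 by ring] at r2
  have e2 : sinAbsMoment (q + 2) = (q + 1) / (q + 2) * sinAbsMoment q := by
    field_simp; linarith
  have e4 : sinAbsMoment (q + 4) = (q + 1) * (q + 3) / ((q + 2) * (q + 4)) * sinAbsMoment q := by
    field_simp; nlinarith [r1, r2]
  rw [integral_famF_rpow_zero hb (by linarith), e2, e4]
  unfold famD; field_simp

/-- **`∫₀¹|F′|^q > 0`** (`q > 1`). [ours, bookkeeping] -/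
theorem integral_famF_rpow_zero_pos (hq : 1 < q) :
    0 < ∫ s in (0 : ℝ)..1, |(famF q b hb).D s + 0 * (famF q b hb).D.D.D s| ^ q := by
  rw [integral_famF_rpow_zero_eq hb hq]
  have hq0 : (0 : ℝ) < q := by linarith
  exact mul_pos (div_pos (famD_pos hq0 b) (mul_pos (mul_pos hq0 (by linarith)) (by linarith)))
    (sinAbsMoment_pos (by linarith))

/-- **HEAT-LINE DROP of the family witness, every real `q > 1`, `b > −1`, and every real `t`:**
`∫₀¹|F′|^q − ∫₀¹|F′ + tF‴|^q ≤ t·ρ(q,b)·∫₀¹|F′|^q`. [ours] -/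
theorem integral_famLine_drop_le (hq : 1 < q) (t : ℝ) :
    (∫ s in (0 : ℝ)..1, |(famF q b hb).D s + 0 * (famF q b hb).D.D.D s| ^ q) -
        ∫ s in (0 : ℝ)..1, |(famF q b hb).D s + t * (famF q b hb).D.D.D s| ^ q ≤
      t * (famRate q b * ∫ s in (0 : ℝ)..1, |(famF q b hb).D s + 0 * (famF q b hb).D.D.D s| ^ q) := by
  have h := integral_famLine_rpow_ge hb hq.le t
  have r1 := sinAbsMoment_rec (r := q) hq
  have r2 := sinAbsMoment_rec (r := q + 2) (by linarith)
  rw [show q + 2 + 2 = q + 4 by ring, show q + 2 + 1 = q + 3 by ring] at r2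
  have e2 : sinAbsMoment (q + 2) = (q + 1) / (q + 2) * sinAbsMoment q := by
    field_simp; linarith
  have e4 : sinAbsMoment (q + 4) = (q + 1) * (q + 3) / ((q + 2) * (q + 4)) * sinAbsMoment q := by
    field_simp; nlinarith [r1, r2]
  rw [e2, e4] at h
  rw [integral_famF_rpow_zero_eq hb hq]
  have hD := (famD_pos (by linarith : (0 : ℝ) < q) b).ne'
  have hq0 : q ≠ 0 := by positivity
  have hq2 : q + 2 ≠ 0 := by positivity
  have hq4 : q + 4 ≠ 0 := by positivity
  have E : famD q b / (q * (q + 2) * (q + 4)) * sinAbsMoment q -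
      ((1 + t * (q * (4 * π ^ 2 * famP0 q b))) * sinAbsMoment q +
        (2 * b + t * (q * (4 * π ^ 2 * famP1 q b))) * ((q + 1) / (q + 2) * sinAbsMoment q) +
        (b ^ 2 + t * (q * (4 * π ^ 2 * famP2 q b))) * ((q + 1) * (q + 3) / ((q + 2) * (q + 4)) *
          sinAbsMoment q)) = t * (famRate q b * (famD q b / (q * (q + 2) * (q + 4)) * sinAbsMoment q)) := by
    unfold famRate
    rw [show 4 * π ^ 2 * famN q b / famD q b * (famD q b / (q * (q + 2) * (q + 4)) * sinAbsMoment q) =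
      4 * π ^ 2 * famN q b * sinAbsMoment q / (q * (q + 2) * (q + 4)) by field_simp]
    unfold famN famD famP0 famP1 famP2
    field_simp
    ring
  linarith [h, E]

/-! ## 2. Booking: `C_λ(q) ≤ ρ(q,b)`, `C_λ^−(q) ≤ ρ(q,b)`, `C_λ^sym(q) ≤ ρ(q,b)` -/

/-- **`Φ_q(u_F) − Φ_q(u_F + tΔu_F) ≤ t·ρ(q,b)·Φ_q(u_F)`** and the same for `Ψ_q` (`q > 1`, every `t`). [ours] -/
theorem famMoment_drop_le (hq : 1 < q) (t : ℝ) :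
    torusTopEigMoment q (lamU (famF q b hb)) -
          torusTopEigMoment q (lamU (famF q b hb) + t • Torus.laplacian (lamU (famF q b hb))) ≤
        t * (famRate q b * torusTopEigMoment q (lamU (famF q b hb))) ∧
      torusNegBotEigMoment q (lamU (famF q b hb)) -
          torusNegBotEigMoment q (lamU (famF q b hb) + t • Torus.laplacian (lamU (famF q b hb))) ≤
        t * (famRate q b * torusNegBotEigMoment q (lamU (famF q b hb))) := by
  have hq0 : 0 < q := by linarith
  obtain ⟨h0, h0'⟩ := topEigMoment_line_half (famF q b hb) 0 hq0
  obtain ⟨ht, ht'⟩ := topEigMoment_line_half (famF q b hb) t hq0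
  rw [zero_smul, add_zero] at h0 h0'
  have hd := mul_le_mul_of_nonneg_left (integral_famLine_drop_le hb hq t) (le_of_lt (rpow_pos_of_pos
    (by norm_num : (0 : ℝ) < 1 / 2) q))
  rw [h0, ht, h0', ht']
  constructor <;> nlinarith [hd]

/-- **`Φ_q(u_F) > 0`** and `Ψ_q(u_F) > 0` (`q > 1`). [ours; bookkeeping] -/
theorem moment_lamU_famF_pos (hq : 1 < q) :
    0 < torusTopEigMoment q (lamU (famF q b hb)) ∧ 0 < torusNegBotEigMoment q (lamU (famF q b hb)) := by
  obtain ⟨h0, h0'⟩ := topEigMoment_line_half (famF q b hb) 0 (by linarith : (0 : ℝ) < q)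
  rw [zero_smul, add_zero] at h0 h0'
  have h := mul_pos (rpow_pos_of_pos (by norm_num : (0 : ℝ) < 1 / 2) q) (integral_famF_rpow_zero_pos hb hq)
  exact ⟨h0 ▸ h, h0' ▸ h⟩

/-- **THEOREM (family ceiling). `C_λ(q) ≤ ρ(q,b)` for every real `q > 1` and every `b > −1`.** [ours] -/
theorem topEigHeatRate_le_famRate (hq : 1 < q) (hb : -1 < b) : topEigHeatRate q ≤ famRate q b := by
  have hΦ := (moment_lamU_famF_pos hb hq).1
  have h := topEigHeatRate_le_ratio hq.le (lamU (famF q b hb)) (isSmooth_lamU _) (isDivFree_lamU _)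
    (hasZeroMean_lamU_famF hb) hΦ
  refine h.trans ((div_le_iff₀ hΦ).2 ?_)
  exact heatDissipation_le_of_line fun t _ => (famMoment_drop_le hb hq t).1

/-- **`C_λ^−(q) ≤ ρ(q,b)`** (`q > 1`, `b > −1`). [ours] -/
theorem negBotEigHeatRate_le_famRate (hq : 1 < q) (hb : -1 < b) : negBotEigHeatRate q ≤ famRate q b := by
  rw [negBotEigHeatRate_eq]; exact topEigHeatRate_le_famRate hq hb

/-- **`C_λ^sym(q) ≤ ρ(q,b)`** (`q > 1`, `b > −1`; the symmetrised core `Φ_q + Ψ_q`, K6's window). [ours] -/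
theorem topBotEigHeatRate_le_famRate (hq : 1 < q) (hb : -1 < b) : topBotEigHeatRate q ≤ famRate q b := by
  obtain ⟨hΦ, hΨ⟩ := moment_lamU_famF_pos hb hq
  have hpos : 0 < topBotEigMoment q (lamU (famF q b hb)) := by
    unfold topBotEigMoment; exact add_pos hΦ hΨ
  have h := topBotEigHeatRate_le_ratio hq.le (lamU (famF q b hb)) (isSmooth_lamU _) (isDivFree_lamU _)
    (hasZeroMean_lamU_famF hb) hpos
  refine h.trans ((div_le_iff₀ hpos).2 ?_)
  unfold topBotEigMoment
  rw [mul_add]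
  exact add_le_add (heatDissipation_le_of_line fun t _ => (famMoment_drop_le hb hq t).1)
    (heatDissipation_le_of_line fun t _ => (famMoment_drop_le hb hq t).2)

/-- **Every rate above `ρ(q,b)` is REFUTED for `∫(λ₁⁺)^q`**: `ρ(q,b) < c → ¬ TopEigHeatCoercive q c`. [ours] -/
theorem not_topEigHeatCoercive_of_famRate_lt (hq : 1 < q) (hb : -1 < b) {c : ℝ} (hc : famRate q b < c) :
    ¬ TopEigHeatCoercive (d := Fin 3) q c := fun h =>
  not_le.2 (hc.trans_le' (topEigHeatRate_le_famRate hq hb)) ((topEigHeatCoercive_iff_le_rate hq.le).1 h)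

/-! ## 3. Strictness of the Poincaré ceiling for every real `q ≥ 1`, `q ≠ 2` -/

/-- `ρ(q,0) = 4π²q`: the pure sine reproduces the Poincaré rate (`q > 0`). [ours, bookkeeping] -/
theorem famRate_zero_right (hq : 0 < q) : famRate q 0 = 4 * π ^ 2 * q := by
  have hD := famD_pos hq 0
  unfold famRate
  rw [div_eq_iff hD.ne']
  unfold famN famD; ring

/-- **`N − qD = 4b·(q(q+4)(q−2) + b(q+1)(q²+2q−4))`.** [ours, bookkeeping] -/
theorem famN_sub (q b : ℝ) :
    famN q b - q * famD q b = 4 * b * (q * (q + 4) * (q - 2) + b * ((q + 1) * (q ^ 2 + 2 * q - 4))) := by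
  unfold famN famD; ring

/-- **The parameter `b⋆(q) := (2 − q)/(2q³)`.** [ours, bookkeeping] -/
def famBStar (q : ℝ) : ℝ := (2 - q) / (2 * q ^ 3)

/-- `b⋆(q) > −1` for `q ≥ 1`. [ours, bookkeeping] -/
theorem famBStar_gt (hq : 1 ≤ q) : -1 < famBStar q := by
  unfold famBStar
  rw [lt_div_iff₀ (by positivity)]
  nlinarith [mul_nonneg (mul_nonneg (by linarith : (0 : ℝ) ≤ q) (by linarith : (0 : ℝ) ≤ q - 1))
    (by linarith : (0 : ℝ) ≤ q + 1)]

/-- **`ρ(q, b⋆(q)) < 4π²q`** for every real `q ≥ 1` with `q ≠ 2`. [ours] -/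
theorem famRate_bStar_lt (hq : 1 ≤ q) (h2 : q ≠ 2) : famRate q (famBStar q) < 4 * π ^ 2 * q := by
  have hq0 : 0 < q := by linarith
  have hD := famD_pos hq0 (famBStar q)
  have hsub : famN q (famBStar q) - q * famD q (famBStar q) < 0 := by
    rw [famN_sub]
    unfold famBStar
    have e : 4 * ((2 - q) / (2 * q ^ 3)) * (q * (q + 4) * (q - 2) + (2 - q) / (2 * q ^ 3) *
        ((q + 1) * (q ^ 2 + 2 * q - 4))) =
        -((q - 2) ^ 2 * (2 * q ^ 4 * (q + 4) - (q + 1) * (q ^ 2 + 2 * q - 4)) / q ^ 6) := by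
      field_simp; ring
    rw [e, neg_lt_zero]
    have hK : 0 < 2 * q ^ 4 * (q + 4) - (q + 1) * (q ^ 2 + 2 * q - 4) := by
      nlinarith [pow_pos hq0 2, pow_pos hq0 3, pow_le_pow_left₀ zero_le_one hq 4, pow_le_pow_left₀ zero_le_one hq 2]
    have h2' : 0 < (q - 2) ^ 2 := sq_pos_iff.2 (sub_ne_zero.2 h2)
    positivity
  unfold famRate
  rw [div_lt_iff₀ hD]
  nlinarith [mul_pos (pow_pos pi_pos 2) hD, pow_pos pi_pos 2]

/-- **HEADLINE. The Poincaré ceiling on Lemma L-λ's constant is STRICT: `C_λ(q) < 4π²q` for every real `q ≥ 1`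
with `q ≠ 2`** (the endpoint `q = 1` is K32's `C_λ(1) = 0`). [ours] -/
theorem topEigHeatRate_lt_poincare (hq : 1 ≤ q) (h2 : q ≠ 2) : topEigHeatRate q < 4 * π ^ 2 * q := by
  rcases hq.eq_or_lt with rfl | hq'
  · rw [topEigHeatRate_one]; positivity
  · exact (topEigHeatRate_le_famRate hq' (famBStar_gt hq)).trans_lt (famRate_bStar_lt hq h2)

/-- **`C_λ^−(q) < 4π²q`** (`q ≥ 1`, `q ≠ 2`). [ours] -/
theorem negBotEigHeatRate_lt_poincare (hq : 1 ≤ q) (h2 : q ≠ 2) : negBotEigHeatRate q < 4 * π ^ 2 * q := by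
  rw [negBotEigHeatRate_eq]; exact topEigHeatRate_lt_poincare hq h2

/-- **HEADLINE (symmetrised). `C_λ^sym(q) < 4π²q` for every real `q ≥ 1` with `q ≠ 2`** (at `q = 1` via K32's
`¬ TopBotEigHeatCoercivePos 1` and K6's dichotomy). [ours] -/
theorem topBotEigHeatRate_lt_poincare (hq : 1 ≤ q) (h2 : q ≠ 2) : topBotEigHeatRate q < 4 * π ^ 2 * q := by
  rcases hq.eq_or_lt with rfl | hq'
  · rw [(not_topBotEigHeatCoercivePos_iff_rate_eq_zero le_rfl).1 not_topBotEigHeatCoercivePos_one]; positivity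
  · exact (topBotEigHeatRate_le_famRate hq' (famBStar_gt hq)).trans_lt (famRate_bStar_lt hq h2)

/-- **NO-GO FORM: the single-shell rate is NOT an admissible heat rate for `∫(λ₁⁺)^q` at any real `q ≥ 1`, `q ≠ 2`:
`¬ TopEigHeatCoercive q (4π²q)`.** [ours] -/
theorem not_topEigHeatCoercive_poincare (hq : 1 ≤ q) (h2 : q ≠ 2) :
    ¬ TopEigHeatCoercive (d := Fin 3) q (4 * π ^ 2 * q) := fun h =>
  not_le.2 (topEigHeatRate_lt_poincare hq h2) ((topEigHeatCoercive_iff_le_rate hq).1 h)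

/-- **`¬ HeatCoercive (Φ_q + Ψ_q) (4π²q)`** (`q ≥ 1`, `q ≠ 2`). [ours] -/
theorem not_topBotEigHeatCoercive_poincare (hq : 1 ≤ q) (h2 : q ≠ 2) :
    ¬ HeatCoercive (d := Fin 3) (topBotEigMoment q) (4 * π ^ 2 * q) := fun h =>
  not_le.2 (topBotEigHeatRate_lt_poincare hq h2) ((topBotEigHeatCoercive_iff_le_rate hq).1 h)

/-- **At `q = 2` the family is rigid: `N(2,b) − 2D(2,b) = 48b²`.** [ours, bookkeeping] -/
theorem famN_sub_two (b : ℝ) : famN 2 b - 2 * famD 2 b = 48 * b ^ 2 := by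
  rw [famN_sub]; ring

/-- `8π² ≤ ρ(2,b)` for every real `b` (consistent with the tree's `laminate_rigid_two`). [ours, bookkeeping] -/
theorem famRate_two_ge (b : ℝ) : 8 * π ^ 2 ≤ famRate 2 b := by
  have hD := famD_pos (by norm_num : (0 : ℝ) < 2) b
  unfold famRate
  rw [le_div_iff₀ hD]
  nlinarith [famN_sub_two b, mul_nonneg (le_of_lt (pow_pos pi_pos 2)) (sq_nonneg b)]

/-! ## 4. Sample windows at `q = 3, 4, 8` (exact rationals) -/

/-- `ρ(3, −3/10) = (5796/509)π²`, `ρ(4, −2/5) = (128/9)π²`, `ρ(8, −2/3) = 24π²`. [ours, bookkeeping] -/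
theorem famRate_values : famRate 3 (-3 / 10) = 5796 / 509 * π ^ 2 ∧ famRate 4 (-2 / 5) = 128 / 9 * π ^ 2 ∧
    famRate 8 (-2 / 3) = 24 * π ^ 2 := by
  refine ⟨?_, ?_, ?_⟩ <;> norm_num [famRate, famN, famD] <;> ring

/-- **`C_λ^sym(3) ≤ (5796/509)π² < 11.4π²`** (tree: `12π²`), and `C_λ(3) ≤ C_λ^sym(3)`. [ours] -/
theorem topBotEigHeatRate_three_le : topBotEigHeatRate 3 ≤ 5796 / 509 * π ^ 2 ∧
    topEigHeatRate 3 ≤ 5796 / 509 * π ^ 2 ∧ (5796 / 509 : ℝ) * π ^ 2 < 57 / 5 * π ^ 2 := by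
  have h := topBotEigHeatRate_le_famRate (q := 3) (b := -3 / 10) (by norm_num) (by norm_num)
  rw [famRate_values.1] at h
  exact ⟨h, (topEigHeatRate_le_topBotEigHeatRate (by norm_num)).trans h,
    mul_lt_mul_of_pos_right (by norm_num) (pow_pos pi_pos 2)⟩

/-- **`C_λ^sym(4) ≤ (128/9)π²`** (tree: `16π²`), and `C_λ(4) ≤ (128/9)π²`. [ours] -/
theorem topBotEigHeatRate_four_le : topBotEigHeatRate 4 ≤ 128 / 9 * π ^ 2 ∧ topEigHeatRate 4 ≤ 128 / 9 * π ^ 2 := by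
  have h := topBotEigHeatRate_le_famRate (q := 4) (b := -2 / 5) (by norm_num) (by norm_num)
  rw [famRate_values.2.1] at h
  exact ⟨h, (topEigHeatRate_le_topBotEigHeatRate (by norm_num)).trans h⟩

/-- **`C_λ^sym(8) ≤ 24π²`** (tree: `32π²`), and `C_λ(8) ≤ 24π²`. [ours] -/
theorem topBotEigHeatRate_eight_le : topBotEigHeatRate 8 ≤ 24 * π ^ 2 ∧ topEigHeatRate 8 ≤ 24 * π ^ 2 := by
  have h := topBotEigHeatRate_le_famRate (q := 8) (b := -2 / 3) (by norm_num) (by norm_num)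
  rw [famRate_values.2.2] at h
  exact ⟨h, (topEigHeatRate_le_topBotEigHeatRate (by norm_num)).trans h⟩

end TopEigLaminate

end Summit.NavierStokesRegularity.FunctionalMining

end
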